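/-
Copyright (c) 2026 the pub-hodgecm-mathlib formalisation cell (harness21).  Prover seat hodgecm-mathlib-R90-C10-p05 (g2) = LEAD of line «B_pos-inert» (R90-TF SLAB section S1
«Ch10-local», base R90-C10; h413 = `stmt-HodgeConjecture-24833`): THE HEAD OF RECORD (B-7⁺) of U4Keys :182 in BRANCH B at positive depth at EVERY inert place (R-S1-17 of the S1
chair: the frozen (B-7) head with the parity selector `h2` DELETED), assembled from the hypothesis-first leaf body ★ p863671 (R90-C10-p02 (g3)) and the discharge of its one
letter `HE` (★ `R90S1BposPairEntriesOfMaster`, R90-C10-p02 (g3), over the master integral ★ `R90S1BposMasterIntegral` of R90-C10-p06 (g3) ∕ this seat's parts 1–2, (B-5v)).  2026-09-05.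
-/
import Summits.HodgeConjecture.HodgeConjecture.Theorems.R90S1KeysThmTwoPosDepthBranchBInertAllLeaf   -- ★ p863671 (R90-C10-p02 (g3)): `exists_eta_of_reducible_posDepth_normTrivial_inertAll_of_pairEntries` (the leaf modulo the letter `HE`)
import Summits.HodgeConjecture.HodgeConjecture.Theorems.R90S1BposPairEntriesOfMaster               -- ★ (R90-C10-p02 (g3)) (B-5z) FILE C: `pairEntries_of_master` — the discharge of `HE` (letter-free: ★ p864299 master integral, ★ p864058 box volumes inside)
import HarnessLib

/-!
# R90-TF S1 «Ch10-local» ∕ K2 E3 «U4Keys» :182 — BRANCH B AT POSITIVE DEPTH, EVERY INERT PLACE: THE HEAD OF RECORD (B-7⁺)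
# «`v` non-split and unramified in `L`, `χ₁` continuous, non-unitary, contracting, of positive depth, `χ₁(u·σu) = 1` on units, `i(χ₁, 1)` reducible ⟹ `χ₁ = η·‖·‖^{1∕2}`, `η` quadratic»
# [Keys1984 §7 Thm (2); Rogawski1990 §12.2 (1)–(2); Roche1998 §3–§4; Casselman1980 §3]

Cell `pub/hodgecm-mathlib`, crux H413 = `stmt-HodgeConjecture-24833`, route of record `HCCMUnconditional` (no route verbs); R90-TF section S1 (junction socket A2′ = U4Keys :217,
REL over :155 (★ ED. 9) and :182).  THEOREMS ONLY (no `def`, no `instance`, no `notation`, no named-fact hypothesis, no `sorry`); lane `--supports stmt-HodgeConjecture-24833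
--as helper`, count-neutral.  NOT THE PAYER of :182: the K2E3 pen closes the Branch-B inert disjunct of :182 ∕ (S-I) by ONE `Or.inr (exists_eta_of_reducible_posDepth_normTrivial_inertAll …)`
(junction cert `R90/R90-C10-typ1/g4/cert_SI_vs_B7plus.lean` 8fc5a3d1f6bb751c, R90-C10-typ1 (g4)); the binder list below is that cert's (B-7⁺) head VERBATIM (`hram` is carried for the
socket's ∀-text and not used: positive depth `hpos` already forces ramification).
THE LINE (memo `R90/R90-C10-p05/g2/DESIGN-Bpos-inert.md`, «d0B programme at Roche's two-depth group `J_e`, `e = (⌊N∕2⌋, 0; ⌈N∕2⌉, 1)`, `N = cond χ₁ ≥ 2`»): reducible ⟹ a `(J_e, θ)`-type vector in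
a proper `G`-stable subspace killed by every intertwining functional (★ (B-1a)) ⟹ the `2 × 2` Casselman determinant of the normalised type basis (★ (B-1′), ★ (B-8)) over the cells
(★ (B-2b″), ★ (B-0)) vanishes ⟹ with the four entries — the MASTER INTEGRAL of the Casselman integrand over the cut-off regions of `N(L⁺_v)` through the trace-one shear of the
Heisenberg chart (★ parts 1–2, ★ (B-5b), ★ (B-9c), ★ (B-5x), ★ part 3) and the sheared box volumes (★ (B-5v)), assembled in ★ (B-5z) — `(qX + 1)(X + q) = 0` for `X = χ₁(ϖ̂)` (★ (B-6),
★ Z4) ⟹ `χ₁ = η·‖·‖^{1∕2}` (★ Z5).  ALL inert places, dyadic included (no `|2|_w = 1` anywhere on the path).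
* **`exists_eta_of_reducible_posDepth_normTrivial_inertAll`** — the head (B-7⁺); `exists_eta_of_reducible_posDepth_normTrivial_inert` — the frozen (B-7) head (with the idle parity
  selector `h2`) as its corollary.
HONEST LABEL.  HC_CM is proved only modulo the 7 printed citations (2 remaining named inputs: hLiu418 = `stmt-HodgeConjecture-24832`, h413 = `stmt-HodgeConjecture-24833`) until rung 0
closes; count-neutral — this file does NOT pay :182 or A2′ by itself (the K2E3 pen's `Or.inr` does, inside the U4Keys line); no printed citation is discharged.

## References
* [Keys1984] D. Keys, *Principal series representations of special unitary groups over local fields*, Compositio Math. 51 (1984), §7 Theorem (2) (b)–(d) p. 126.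
* [Rogawski1990] J. D. Rogawski, *Automorphic Representations of Unitary Groups in Three Variables*, Ann. of Math. Stud. 123 (1990), §12.2 (1)–(2) p. 173.
* [Roche1998] A. Roche, *Types and Hecke algebras for principal series representations of split reductive p-adic groups*, Ann. Sci. ÉNS (4) 31 (1998), §3–§4.
* [Casselman1980] W. Casselman, *The unramified principal series of p-adic groups I*, Compositio Math. 40 (1980), §3.
-/

set_option autoImplicit false
set_option linter.dupNamespace false  -- the mandated namespace has the single-problem summit's repeated segment (`HodgeConjecture.HodgeConjecture`)

noncomputable section

open NumberField IsDedekindDomain MeasureTheory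
open scoped Matrix MatrixGroups WithZero Valued NNReal
open Literature.NumberTheory Literature.NumberTheory.Automorphic Literature.NumberTheory.Automorphic.UnitaryGroup
open Literature.NumberTheory.Rogawski1990

namespace Summit.HodgeConjecture.HodgeConjecture.R90.S1

open Summit.HodgeConjecture.HodgeConjecture.Cruxes.H413

variable (L : Type) [Field L] [NumberField L] [IsCMField L] (v : HeightOneSpectrum (𝓞 ↥(maximalRealSubfield L)))

/-- **U4Keys :182 IN BRANCH B AT POSITIVE DEPTH, EVERY INERT PLACE (the head (B-7⁺)).**  `v` non-split (`hns`) and UNRAMIFIED in `L` (`hunr`, any residue characteristic); `χ₁ : (L ⊗ L⁺_v)ˣ → ℂˣ`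
continuous (`h₁`), non-unitary (`hnu`), contracting (`hcontr`), ramified (`hram`, idle), of positive depth (`hpos`), with `χ₁(u·σu) = 1` on the units of valuation one (`hB`, Branch B);
if `i(χ₁, 1)` is reducible (`hred`) then `χ₁ = η·‖·‖^{1∕2}` for a continuous quadratic character extension `η` — DISJUNCT 2 of :182.  One term: ★ p863671's leaf modulo `HE` with `HE`
discharged by ★ (B-5z) FILE C `pairEntries_of_master`. [cite: Keys1984, §7 Theorem (2) (b)–(d) p. 126] [cite: Rogawski1990, §12.2 (1)–(2) p. 173] [cite: Roche1998, §3–§4] [cite: Casselman1980, §3] -/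
theorem exists_eta_of_reducible_posDepth_normTrivial_inertAll
    (hns : ∀ w' : PlacesOver L v, IsCMField.complexConj L • w'.1 = w'.1)
    (hunr : Algebra.IsUnramifiedIn (𝓞 L) v.asIdeal)
    (χ₁ : (LocalRing L v)ˣ →* ℂˣ) (h₁ : Continuous fun x => ((χ₁ x : ℂˣ) : ℂ)) (hnu : ∃ x, ‖((χ₁ x : ℂˣ) : ℂ)‖ ≠ 1)
    (hcontr : ∀ x : (LocalRing L v)ˣ, unitModulusChar (LocalRing L v) x < 1 → ‖((χ₁ x : ℂˣ) : ℂ)‖ < 1)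
    (_hram : ¬ (∀ u ∈ (Submonoid.pi Set.univ (fun w : PlacesOver L v => (w.1.adicCompletionIntegers L).toSubring.toSubmonoid)).units, χ₁ u = 1))
    (hpos : ∃ u : (LocalRing L v)ˣ, (∀ w' : PlacesOver L v, Valued.v (((u : LocalRing L v) w') - 1) < 1) ∧ χ₁ u ≠ 1)
    (hB : ∀ u : (LocalRing L v)ˣ, (∀ w' : PlacesOver L v, Valued.v ((u : LocalRing L v) w') = 1) →
      χ₁ (u * Units.map (conjLocal L (IsCMField.complexConj L) v : LocalRing L v →* LocalRing L v) u) = 1)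
    (hred : ∃ N : Subrepresentation (cmPrincipalSeries L 3 v (cmTorusCharPair L v χ₁ 1)), N ≠ ⊥ ∧ N ≠ ⊤) :
    ∃ η : (LocalRing L v)ˣ →* ℂˣ, IsQuadraticCharExtension (conjLocal L (IsCMField.complexConj L) v) η ∧
      Continuous (fun x => ((η x : ℂˣ) : ℂ)) ∧ χ₁ = η * halfModulusChar (LocalRing L v) :=
  KeysThmTwoPosDepthBranchBInertAllLeaf.exists_eta_of_reducible_posDepth_normTrivial_inertAll_of_pairEntries L v hns hunr χ₁ h₁ hnu hcontr hpos hB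
    (BposPairEntriesOfMaster.pairEntries_of_master L v hns hunr χ₁ h₁ hcontr hB) hred

/-- **The frozen (B-7) head** (inert place with the idle parity selector `h2 : |2|_{w′} = 1`): the corollary of the head (B-7⁺) above.
[cite: Keys1984, §7 Theorem (2) (b)–(d) p. 126] [cite: Rogawski1990, §12.2 (1)–(2) p. 173] -/
theorem exists_eta_of_reducible_posDepth_normTrivial_inert
    (hns : ∀ w' : PlacesOver L v, IsCMField.complexConj L • w'.1 = w'.1)
    (hunr : Algebra.IsUnramifiedIn (𝓞 L) v.asIdeal)
    (_h2 : ∀ w' : PlacesOver L v, Valued.v (2 : w'.1.adicCompletion L) = 1)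
    (χ₁ : (LocalRing L v)ˣ →* ℂˣ) (h₁ : Continuous fun x => ((χ₁ x : ℂˣ) : ℂ)) (hnu : ∃ x, ‖((χ₁ x : ℂˣ) : ℂ)‖ ≠ 1)
    (hcontr : ∀ x : (LocalRing L v)ˣ, unitModulusChar (LocalRing L v) x < 1 → ‖((χ₁ x : ℂˣ) : ℂ)‖ < 1)
    (hram : ¬ (∀ u ∈ (Submonoid.pi Set.univ (fun w : PlacesOver L v => (w.1.adicCompletionIntegers L).toSubring.toSubmonoid)).units, χ₁ u = 1))
    (hpos : ∃ u : (LocalRing L v)ˣ, (∀ w' : PlacesOver L v, Valued.v (((u : LocalRing L v) w') - 1) < 1) ∧ χ₁ u ≠ 1)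
    (hB : ∀ u : (LocalRing L v)ˣ, (∀ w' : PlacesOver L v, Valued.v ((u : LocalRing L v) w') = 1) →
      χ₁ (u * Units.map (conjLocal L (IsCMField.complexConj L) v : LocalRing L v →* LocalRing L v) u) = 1)
    (hred : ∃ N : Subrepresentation (cmPrincipalSeries L 3 v (cmTorusCharPair L v χ₁ 1)), N ≠ ⊥ ∧ N ≠ ⊤) :
    ∃ η : (LocalRing L v)ˣ →* ℂˣ, IsQuadraticCharExtension (conjLocal L (IsCMField.complexConj L) v) η ∧
      Continuous (fun x => ((η x : ℂˣ) : ℂ)) ∧ χ₁ = η * halfModulusChar (LocalRing L v) :=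
  exists_eta_of_reducible_posDepth_normTrivial_inertAll L v hns hunr χ₁ h₁ hnu hcontr hram hpos hB hred

end Summit.HodgeConjecture.HodgeConjecture.R90.S1

end
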